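import Mathlib
import HarnessLib
import Summits.CriticalPhenomena.SAWScalingLimit.Theorems.SAWTowerCountSpectralPinExpSum

/-!
# SpectralPin, a priori bounds: the top rate and the top coefficient stay bounded
(route `SAWTowerCount`, support item stmt-CriticalPhenomena-7259 `SpectralPin`; helper, `--supports`).

Abstract (SAW-free) form of Steps 0, 2, 3 of the exponential-fitting argument.
* Step 0 (`eventually_two_sided`): a function with the `PoissonKernelExpansion`-shaped three-term
  expansion `Φ(m) = κ(e^{−bπm} + K₁e^{−(b+1)πm} + K₂e^{−(b+2)πm}) + O(e^{−(b+3)πm})`, `κ > 0`, satisfies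
  `κe^{−bπm}/2 ≤ Φ(m) ≤ 2κe^{−bπm}` for all large `m`.
* Step 2 (`bracket`): under a `LevelTwoSolitude`-shaped representation WITH A UNIFORM LEVEL-1 GAP
  `g_k ≥ δ₀ > 0 (k ≥ 1)`, at integer depths `j` the lattice function is pinched around its top term:
  `|f − a e^{−ψ j}| ≤ a e^{−ψ j}·(Kmax+1)C₀e^{−δ₀ j}`.
* Step 3 (`apriori_bounds`): comparing the two at two consecutive large integer depths `T₀, T₀+1`
  where `f → Φ`, the top rate `ψ n` and the normalised top coefficients `a n p q` are bounded above
  and below (away from `0`) for all large `n` — the compactness input of the limit extraction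
  (`SAWTowerCountSpectralPinLimit`).  This is exactly where the gap hypothesis is needed: without it a
  cancelling partner `e₁ = −1`, `g₁ → 0` makes `a n → ∞` compatible with everything else
  (item evidence `SpectralPin-misstated.md`).  Mathlib only; no cited facts.
-/

noncomputable section

namespace Summit.CriticalPhenomena.SAWScalingLimit.Theorems.SpectralPin

open Filter Topology Finset

/-! ### Step 0: two-sided pinching of `Φ` from its three-term expansion -/

/-- Pure inequality behind Step 0. -/
theorem two_sided_of_expansion (κ K₁ K₂ C Φm E x : ℝ) (hκ : 0 < κ) (hE : 0 < E) (hx : 0 ≤ x)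
    (h : |Φm - κ * (E + K₁ * (E * x) + K₂ * (E * x ^ 2))| ≤ C * (E * x ^ 3))
    (hsmall : |K₁| * x + |K₂| * x ^ 2 + |C| / κ * x ^ 3 ≤ 1 / 2) :
    κ * E / 2 ≤ Φm ∧ Φm ≤ 2 * (κ * E) := by
  have hKE : 0 < κ * E := mul_pos hκ hE
  have hx2 : 0 ≤ x ^ 2 := by positivity
  have hx3 : 0 ≤ x ^ 3 := by positivity
  obtain ⟨hlo, hhi⟩ := abs_le.mp h
  have l1 : -(|K₁| * x) ≤ K₁ * x := by nlinarith [neg_abs_le K₁]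
  have u1 : K₁ * x ≤ |K₁| * x := by nlinarith [le_abs_self K₁]
  have l2 : -(|K₂| * x ^ 2) ≤ K₂ * x ^ 2 := by nlinarith [neg_abs_le K₂]
  have u2 : K₂ * x ^ 2 ≤ |K₂| * x ^ 2 := by nlinarith [le_abs_self K₂]
  have l3 : -(|C| * (E * x ^ 3)) ≤ -(C * (E * x ^ 3)) := by
    have := le_abs_self C; nlinarith [mul_nonneg hE.le hx3]
  have u3 : C * (E * x ^ 3) ≤ |C| * (E * x ^ 3) := by
    have := le_abs_self C; nlinarith [mul_nonneg hE.le hx3]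
  -- `S := |K₁|x + |K₂|x² + (|C|/κ)x³ ≤ 1/2`, and `κ E S = κE|K₁|x + κE|K₂|x² + |C|E x³`
  have hS : κ * E * (|K₁| * x) + κ * E * (|K₂| * x ^ 2) + |C| * (E * x ^ 3) ≤ κ * E / 2 := by
    have : κ * E * (|K₁| * x + |K₂| * x ^ 2 + |C| / κ * x ^ 3) ≤ κ * E * (1 / 2) :=
      mul_le_mul_of_nonneg_left hsmall hKE.le
    have hid : κ * E * (|K₁| * x + |K₂| * x ^ 2 + |C| / κ * x ^ 3) =
        κ * E * (|K₁| * x) + κ * E * (|K₂| * x ^ 2) + |C| * (E * x ^ 3) := by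
      field_simp
    linarith
  have m1 : κ * E * (K₁ * x) ≥ -(κ * E * (|K₁| * x)) := by nlinarith
  have m1' : κ * E * (K₁ * x) ≤ κ * E * (|K₁| * x) := by nlinarith
  have m2 : κ * E * (K₂ * x ^ 2) ≥ -(κ * E * (|K₂| * x ^ 2)) := by nlinarith
  have m2' : κ * E * (K₂ * x ^ 2) ≤ κ * E * (|K₂| * x ^ 2) := by nlinarith
  have hexp : κ * (E + K₁ * (E * x) + K₂ * (E * x ^ 2)) =
      κ * E + κ * E * (K₁ * x) + κ * E * (K₂ * x ^ 2) := by ring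
  rw [hexp] at hlo hhi
  constructor <;> nlinarith

/-- `e^{−((b+j)πm)} = e^{−bπm} (e^{−πm})^j` bookkeeping. -/
theorem exp_shift (b m : ℝ) (j : ℕ) :
    Real.exp (-((b + j) * Real.pi * m)) =
      Real.exp (-(b * Real.pi * m)) * Real.exp (-(Real.pi * m)) ^ j := by
  rw [← Real.exp_nat_mul, ← Real.exp_add]
  congr 1; ring

/-- **Step 0.** Two-sided pinching of `Φ` around `κ e^{−bπm}` for all large `m`. -/
theorem eventually_two_sided (b κ K₁ K₂ C_P m_P : ℝ) (hκ : 0 < κ) (Φ : ℝ → ℝ)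
    (hPKE : ∀ m : ℝ, m_P ≤ m →
      |Φ m - κ * (Real.exp (-(b * Real.pi * m)) + K₁ * Real.exp (-((b + 1) * Real.pi * m)) +
        K₂ * Real.exp (-((b + 2) * Real.pi * m)))| ≤ C_P * Real.exp (-((b + 3) * Real.pi * m))) :
    ∀ᶠ m in atTop, κ * Real.exp (-(b * Real.pi * m)) / 2 ≤ Φ m ∧
      Φ m ≤ 2 * (κ * Real.exp (-(b * Real.pi * m))) := by
  -- the small quantity tends to zero
  have hx : Tendsto (fun m : ℝ => Real.exp (-(Real.pi * m))) atTop (𝓝 0) :=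
    Real.tendsto_exp_atBot.comp (tendsto_neg_atTop_atBot.comp
      (tendsto_id.const_mul_atTop Real.pi_pos))
  have hS : Tendsto (fun m : ℝ => |K₁| * Real.exp (-(Real.pi * m)) +
      |K₂| * Real.exp (-(Real.pi * m)) ^ 2 + |C_P| / κ * Real.exp (-(Real.pi * m)) ^ 3)
      atTop (𝓝 0) := by
    have := ((hx.const_mul |K₁|).add ((hx.pow 2).const_mul |K₂|)).add
      ((hx.pow 3).const_mul (|C_P| / κ))
    simpa using this
  have hsmall : ∀ᶠ m : ℝ in atTop, |K₁| * Real.exp (-(Real.pi * m)) +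
      |K₂| * Real.exp (-(Real.pi * m)) ^ 2 + |C_P| / κ * Real.exp (-(Real.pi * m)) ^ 3 ≤ 1 / 2 :=
    hS.eventually (ge_mem_nhds (by norm_num : (0 : ℝ) < 1 / 2))
  filter_upwards [hsmall, eventually_ge_atTop m_P] with m hm hmP
  have h := hPKE m hmP
  have e1 := exp_shift b m 1
  have e2 := exp_shift b m 2
  have e3 := exp_shift b m 3
  simp only [Nat.cast_one, Nat.cast_ofNat, pow_one] at e1 e2 e3
  rw [e1, e2, e3] at h
  have h' : |Φ m - κ * (Real.exp (-(b * Real.pi * m)) +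
      K₁ * (Real.exp (-(b * Real.pi * m)) * Real.exp (-(Real.pi * m))) +
      K₂ * (Real.exp (-(b * Real.pi * m)) * Real.exp (-(Real.pi * m)) ^ 2))| ≤
      C_P * (Real.exp (-(b * Real.pi * m)) * Real.exp (-(Real.pi * m)) ^ 3) := by
    simpa [mul_comm, mul_left_comm, mul_assoc] using h
  exact two_sided_of_expansion κ K₁ K₂ C_P (Φ m) _ _ hκ (Real.exp_pos _) (Real.exp_pos _).le h' hm

/-! ### Step 2: pinching of the lattice function around its top term at integer depths -/

/-- **Step 2.** Under a gapped exponential-sum representation, at an integer depth `j` with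
`τ = j`, the function is within the relative error `(Kmax+1)C₀e^{−δ₀ j}` of its top term. -/
theorem bracket (Kmax : ℕ) (C₀ δ₀ ψ a fm : ℝ) (hδ₉ : δ₀ ≤ 9 / 4 * Real.pi)
    (g : ℕ → ℝ) (c : ℕ → ℝ) (j : ℕ) (ha : 0 < a)
    (hgap : ∀ k, 1 ≤ k → δ₀ ≤ g k) (hc0 : c 0 = 1) (hg0 : g 0 = 0) (hcb : ∀ k, |c k| ≤ C₀)
    (hrep : |fm - a * ∑ k ∈ Finset.range (Kmax + 1), c k * Real.exp (-((ψ + g k) * j))| ≤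
      C₀ * a * Real.exp (-((ψ + 9 / 4 * Real.pi) * j))) :
    |fm - a * Real.exp (-(ψ * j))| ≤
      a * Real.exp (-(ψ * j)) * ((Kmax + 1) * C₀ * Real.exp (-(δ₀ * j))) := by
  have hj : (0 : ℝ) ≤ j := Nat.cast_nonneg j
  have hC₀ : 0 ≤ C₀ := le_trans (abs_nonneg _) (hcb 0)
  set E : ℝ := Real.exp (-(ψ * j)) with hE
  have hEpos : 0 < E := Real.exp_pos _
  -- split off the `k = 0` term
  have hsplit : ∑ k ∈ Finset.range (Kmax + 1), c k * Real.exp (-((ψ + g k) * j)) =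
      E + ∑ k ∈ (Finset.range (Kmax + 1)).erase 0, c k * Real.exp (-((ψ + g k) * j)) := by
    rw [← Finset.add_sum_erase _ _ (Finset.mem_range.mpr (Nat.succ_pos Kmax)), hc0, hg0]
    simp [hE]
  -- bound on the remaining terms
  have hterm : ∀ k ∈ (Finset.range (Kmax + 1)).erase 0,
      |c k * Real.exp (-((ψ + g k) * j))| ≤ C₀ * (E * Real.exp (-(δ₀ * j))) := by
    intro k hk
    have hk1 : 1 ≤ k := Nat.one_le_iff_ne_zero.mpr (Finset.ne_of_mem_erase hk)
    rw [abs_mul, Real.abs_exp]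
    refine mul_le_mul (hcb k) ?_ (Real.exp_pos _).le hC₀
    rw [hE, ← Real.exp_add]
    exact Real.exp_le_exp.mpr (by nlinarith [hgap k hk1])
  have hrest : |∑ k ∈ (Finset.range (Kmax + 1)).erase 0, c k * Real.exp (-((ψ + g k) * j))| ≤
      Kmax * (C₀ * (E * Real.exp (-(δ₀ * j)))) := by
    refine (Finset.abs_sum_le_sum_abs _ _).trans ?_
    have := Finset.sum_le_sum hterm
    rw [Finset.sum_const, Finset.card_erase_of_mem (Finset.mem_range.mpr (Nat.succ_pos Kmax)),
      Finset.card_range] at this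
    simpa only [Nat.add_sub_cancel, Nat.succ_sub_one, nsmul_eq_mul] using this
  -- the tail allowance is also of this size since `δ₀ ≤ 9π/4`
  have htail : C₀ * a * Real.exp (-((ψ + 9 / 4 * Real.pi) * j)) ≤
      C₀ * a * (E * Real.exp (-(δ₀ * j))) := by
    refine mul_le_mul_of_nonneg_left ?_ (mul_nonneg hC₀ ha.le)
    rw [hE, ← Real.exp_add]
    exact Real.exp_le_exp.mpr (by nlinarith)
  calc |fm - a * E|
      = |(fm - a * ∑ k ∈ Finset.range (Kmax + 1), c k * Real.exp (-((ψ + g k) * j))) +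
          a * ∑ k ∈ (Finset.range (Kmax + 1)).erase 0, c k * Real.exp (-((ψ + g k) * j))| := by
        rw [hsplit]; congr 1; ring
    _ ≤ |fm - a * ∑ k ∈ Finset.range (Kmax + 1), c k * Real.exp (-((ψ + g k) * j))| +
          |a * ∑ k ∈ (Finset.range (Kmax + 1)).erase 0, c k * Real.exp (-((ψ + g k) * j))| :=
        abs_add_le _ _
    _ ≤ C₀ * a * (E * Real.exp (-(δ₀ * j))) +
          a * (Kmax * (C₀ * (E * Real.exp (-(δ₀ * j))))) := by
        refine add_le_add (hrep.trans htail) ?_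
        rw [abs_mul, abs_of_pos ha]
        exact mul_le_mul_of_nonneg_left hrest ha.le
    _ = a * E * ((Kmax + 1) * C₀ * Real.exp (-(δ₀ * j))) := by ring

/-! ### Step 3: a priori bounds on the top rate and the top coefficients -/

/-- `min` over the 2×2 grid is a lower bound. -/
theorem min4_le (x : Fin 2 → Fin 2 → ℝ) (p q : Fin 2) :
    min (min (x 0 0) (x 0 1)) (min (x 1 0) (x 1 1)) ≤ x p q := by
  fin_cases p <;> fin_cases q <;>
    simp only [Fin.zero_eta, Fin.isValue, Fin.mk_one, min_le_iff, le_refl, true_or, or_true]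

/-- `max` over the 2×2 grid is an upper bound. -/
theorem le_max4 (x : Fin 2 → Fin 2 → ℝ) (p q : Fin 2) :
    x p q ≤ max (max (x 0 0) (x 0 1)) (max (x 1 0) (x 1 1)) := by
  fin_cases p <;> fin_cases q <;>
    simp only [Fin.zero_eta, Fin.isValue, Fin.mk_one, le_max_iff, le_refl, true_or, or_true]

/-- **Step 3 (a priori bounds).** Under the gapped representation at integer depths (`τ n j = j`),
positivity of all coefficients `a n p q`, and convergence `f n p q m → Φ p q m` towards a function
with a `PoissonKernelExpansion`-shaped expansion (`κ > 0`), the top rates `ψ n` and the top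
coefficients `a n p q` are eventually confined to a compact box with `a` bounded away from `0`. -/
theorem apriori_bounds (b : ℝ) (κ K₁ K₂ : Fin 2 → Fin 2 → ℝ) (C_P m_P : ℝ) (hκ : ∀ p q, 0 < κ p q)
    (Φ : Fin 2 → Fin 2 → ℝ → ℝ)
    (hPKE : ∀ p q, ∀ m : ℝ, m_P ≤ m →
      |Φ p q m - κ p q * (Real.exp (-(b * Real.pi * m)) +
        K₁ p q * Real.exp (-((b + 1) * Real.pi * m)) +
        K₂ p q * Real.exp (-((b + 2) * Real.pi * m)))| ≤ C_P * Real.exp (-((b + 3) * Real.pi * m)))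
    (Kmax : ℕ) (C₀ δ₀ : ℝ) (hδ₀ : 0 < δ₀) (hδ₉ : δ₀ ≤ 9 / 4 * Real.pi)
    (ψ : ℕ → ℝ) (g : ℕ → ℕ → ℝ) (a : ℕ → Fin 2 → Fin 2 → ℝ) (c : ℕ → ℕ → Fin 2 → Fin 2 → ℝ)
    (τ : ℕ → ℝ → ℝ) (f : ℕ → Fin 2 → Fin 2 → ℝ → ℝ) (n₁ : ℕ)
    (hg0 : ∀ n, g n 0 = 0)
    (hgap : ∀ n, n₁ ≤ n → ∀ k, 1 ≤ k → δ₀ ≤ g n k)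
    (hc0 : ∀ n, n₁ ≤ n → ∀ p q, c n 0 p q = 1)
    (hcb : ∀ n, n₁ ≤ n → ∀ k p q, |c n k p q| ≤ C₀)
    (hapos : ∀ n, n₁ ≤ n → ∀ p q, 0 < a n p q)
    (hτint : ∀ n, n₁ ≤ n → ∀ j : ℕ, τ n j = j)
    (hrep : ∀ n, n₁ ≤ n → ∀ p q, ∀ m : ℝ, 1 ≤ m →
      |f n p q m - a n p q * ∑ k ∈ Finset.range (Kmax + 1),
          c n k p q * Real.exp (-((ψ n + g n k) * τ n m))| ≤
        C₀ * a n p q * Real.exp (-((ψ n + 9 / 4 * Real.pi) * τ n m)))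
    (hconv : ∀ p q, ∀ m : ℝ, 1 ≤ m → Tendsto (fun n => f n p q m) atTop (𝓝 (Φ p q m))) :
    ∃ (n₂ : ℕ) (ψlo ψhi alo ahi : ℝ), 0 < alo ∧ ∀ n, n₂ ≤ n →
      (ψlo ≤ ψ n ∧ ψ n ≤ ψhi) ∧ ∀ p q, alo ≤ a n p q ∧ a n p q ≤ ahi := by
  -- Step 0: positivity of `Φ` at all large depths, and smallness of the bracket error
  have hpos : ∀ᶠ m : ℝ in atTop, ∀ p q, 0 < Φ p q m := by
    refine eventually_all.mpr fun p => eventually_all.mpr fun q => ?_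
    filter_upwards [eventually_two_sided b (κ p q) (K₁ p q) (K₂ p q) C_P m_P (hκ p q) (Φ p q)
      (hPKE p q)] with m hm
    exact lt_of_lt_of_le (by have := hκ p q; positivity) hm.1
  have hsm : ∀ᶠ m : ℝ in atTop, (Kmax + 1) * C₀ * Real.exp (-(δ₀ * m)) ≤ 1 / 2 := by
    have : Tendsto (fun m : ℝ => (Kmax + 1) * C₀ * Real.exp (-(δ₀ * m))) atTop (𝓝 0) := by
      have hk : Tendsto (fun m : ℝ => Real.exp (-(δ₀ * m))) atTop (𝓝 0) :=
        Real.tendsto_exp_atBot.comp (tendsto_neg_atTop_atBot.comp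
          (tendsto_id.const_mul_atTop hδ₀))
      simpa using hk.const_mul (((Kmax : ℝ) + 1) * C₀)
    exact this.eventually (ge_mem_nhds (by norm_num : (0 : ℝ) < 1 / 2))
  obtain ⟨M, hM⟩ := eventually_atTop.mp (hpos.and (hsm.and (eventually_ge_atTop (1 : ℝ))))
  set T₀ : ℕ := ⌈M⌉₊ with hT₀
  have hT₀M : M ≤ (T₀ : ℝ) := Nat.le_ceil M
  obtain ⟨hΦ0, hs0, h1T0⟩ := hM T₀ hT₀M
  obtain ⟨hΦ1, hs1, h1T1⟩ := hM ((T₀ + 1 : ℕ) : ℝ) (by push_cast; linarith)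
  -- convergence at the two depths, for the four pairs
  have hcv : ∀ p q (j : ℕ), 1 ≤ (j : ℝ) → 0 < Φ p q j →
      ∀ᶠ n in atTop, |f n p q j - Φ p q j| < Φ p q j / 2 := by
    intro p q j hj hΦ
    have := (hconv p q j hj)
    rw [Metric.tendsto_nhds] at this
    filter_upwards [this (Φ p q j / 2) (half_pos hΦ)] with n hn
    rwa [Real.dist_eq] at hn
  have hcv0 : ∀ᶠ n in atTop, ∀ p q, |f n p q T₀ - Φ p q T₀| < Φ p q T₀ / 2 :=
    eventually_all.mpr fun p => eventually_all.mpr fun q => hcv p q T₀ h1T0 (hΦ0 p q)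
  have hcv1 : ∀ᶠ n in atTop, ∀ p q,
      |f n p q ((T₀ + 1 : ℕ) : ℝ) - Φ p q ((T₀ + 1 : ℕ) : ℝ)| < Φ p q ((T₀ + 1 : ℕ) : ℝ) / 2 :=
    eventually_all.mpr fun p => eventually_all.mpr fun q => hcv p q (T₀ + 1) h1T1 (hΦ1 p q)
  obtain ⟨N, hN⟩ := eventually_atTop.mp (hcv0.and (hcv1.and (eventually_ge_atTop n₁)))
  -- the constants
  set Φ0 : ℝ := Φ 0 0 T₀ with hΦ0def
  set Φ1 : ℝ := Φ 0 0 ((T₀ + 1 : ℕ) : ℝ) with hΦ1def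
  have hΦ0pos : 0 < Φ0 := hΦ0 0 0
  have hΦ1pos : 0 < Φ1 := hΦ1 0 0
  set Φlo : ℝ := min (min (Φ 0 0 T₀) (Φ 0 1 T₀)) (min (Φ 1 0 T₀) (Φ 1 1 T₀)) with hΦlo
  set Φhi : ℝ := max (max (Φ 0 0 T₀) (Φ 0 1 T₀)) (max (Φ 1 0 T₀) (Φ 1 1 T₀)) with hΦhi
  have hΦlopos : 0 < Φlo := by
    simp only [hΦlo, lt_min_iff]; exact ⟨⟨hΦ0 0 0, hΦ0 0 1⟩, hΦ0 1 0, hΦ0 1 1⟩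
  set ψlo : ℝ := -Real.log (9 * Φ1 / Φ0) with hψlo
  set ψhi : ℝ := -Real.log (Φ1 / (9 * Φ0)) with hψhi
  set alo : ℝ := Φlo / 3 * Real.exp (ψlo * T₀) with halo
  set ahi : ℝ := 3 * Φhi * Real.exp (ψhi * T₀) with hahi
  refine ⟨N, ψlo, ψhi, alo, ahi, by positivity, fun n hn => ?_⟩
  obtain ⟨hA, hB, hn₁⟩ := hN n hn
  -- the key two-sided estimate at an integer depth
  have key : ∀ p q (j : ℕ), 1 ≤ (j : ℝ) → (Kmax + 1) * C₀ * Real.exp (-(δ₀ * j)) ≤ 1 / 2 →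
      |f n p q j - Φ p q j| < Φ p q j / 2 →
      Φ p q j / 3 < a n p q * Real.exp (-(ψ n * j)) ∧
        a n p q * Real.exp (-(ψ n * j)) < 3 * Φ p q j := by
    intro p q j hj hs hf
    have hrepj := hrep n hn₁ p q j hj
    rw [hτint n hn₁ j] at hrepj
    have hb := bracket Kmax C₀ δ₀ (ψ n) (a n p q) (f n p q j) hδ₉ (g n) (fun k => c n k p q) j
      (hapos n hn₁ p q) (hgap n hn₁) (hc0 n hn₁ p q) (hg0 n) (fun k => hcb n hn₁ k p q) hrepj
    have haE : 0 < a n p q * Real.exp (-(ψ n * j)) := mul_pos (hapos n hn₁ p q) (Real.exp_pos _)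
    have hb' : |f n p q j - a n p q * Real.exp (-(ψ n * j))| ≤
        a n p q * Real.exp (-(ψ n * j)) / 2 :=
      hb.trans (by nlinarith [mul_le_mul_of_nonneg_left hs haE.le])
    obtain ⟨l1, u1⟩ := abs_le.mp hb'
    obtain ⟨l2, u2⟩ := abs_lt.mp hf
    constructor <;> linarith
  -- bounds on `ψ n` from the pair `(0,0)` at depths `T₀`, `T₀ + 1`
  obtain ⟨hX1, hX2⟩ := key 0 0 T₀ h1T0 hs0 (hA 0 0)
  obtain ⟨hY1, hY2⟩ := key 0 0 (T₀ + 1) h1T1 hs1 (hB 0 0)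
  have hsplit : a n 0 0 * Real.exp (-(ψ n * ((T₀ + 1 : ℕ) : ℝ))) =
      a n 0 0 * Real.exp (-(ψ n * T₀)) * Real.exp (-ψ n) := by
    rw [mul_assoc, ← Real.exp_add]; push_cast; ring_nf
  rw [hsplit] at hY1 hY2
  have hXpos : 0 < a n 0 0 * Real.exp (-(ψ n * T₀)) := mul_pos (hapos n hn₁ 0 0) (Real.exp_pos _)
  have hepos : 0 < Real.exp (-ψ n) := Real.exp_pos _
  have hup : Real.exp (-ψ n) < 9 * Φ1 / Φ0 := by
    rw [lt_div_iff₀ hΦ0pos]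
    nlinarith [mul_lt_mul_of_pos_right hX1 hepos]
  have hdown : Φ1 / (9 * Φ0) < Real.exp (-ψ n) := by
    rw [div_lt_iff₀ (by positivity)]
    nlinarith [mul_lt_mul_of_pos_right hX2 hepos]
  have hψ1 : ψlo ≤ ψ n := by
    have h9 : 0 < 9 * Φ1 / Φ0 := by positivity
    rw [← Real.exp_log h9] at hup
    have := Real.exp_lt_exp.mp hup
    rw [hψlo]; linarith
  have hψ2 : ψ n ≤ ψhi := by
    have h9 : 0 < Φ1 / (9 * Φ0) := by positivity
    rw [← Real.exp_log h9] at hdown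
    have := Real.exp_lt_exp.mp hdown
    rw [hψhi]; linarith
  refine ⟨⟨hψ1, hψ2⟩, fun p q => ?_⟩
  -- bounds on `a n p q`
  obtain ⟨hZ1, hZ2⟩ := key p q T₀ h1T0 hs0 (hA p q)
  have hT₀nn : (0 : ℝ) ≤ T₀ := Nat.cast_nonneg T₀
  have ha_eq : a n p q = a n p q * Real.exp (-(ψ n * T₀)) * Real.exp (ψ n * T₀) := by
    rw [mul_assoc, ← Real.exp_add, neg_add_cancel, Real.exp_zero, mul_one]
  have hlo' : Φlo / 3 ≤ a n p q * Real.exp (-(ψ n * T₀)) := by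
    have := min4_le (fun p q => Φ p q T₀) p q
    rw [← hΦlo] at this
    linarith
  have hhi' : a n p q * Real.exp (-(ψ n * T₀)) ≤ 3 * Φhi := by
    have := le_max4 (fun p q => Φ p q T₀) p q
    rw [← hΦhi] at this
    linarith
  have he1 : Real.exp (ψlo * T₀) ≤ Real.exp (ψ n * T₀) :=
    Real.exp_le_exp.mpr (mul_le_mul_of_nonneg_right hψ1 hT₀nn)
  have he2 : Real.exp (ψ n * T₀) ≤ Real.exp (ψhi * T₀) :=
    Real.exp_le_exp.mpr (mul_le_mul_of_nonneg_right hψ2 hT₀nn)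
  constructor
  · rw [ha_eq, halo]
    exact mul_le_mul hlo' he1 (Real.exp_pos _).le (le_trans (by positivity) hlo')
  · rw [ha_eq, hahi]
    refine mul_le_mul hhi' he2 (Real.exp_pos _).le ?_
    exact le_trans (le_trans (by positivity) hlo') hhi'

end Summit.CriticalPhenomena.SAWScalingLimit.Theorems.SpectralPin
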